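import Literature.InformationTheory.QuantumCodes.AbelianTwoBlockCodes
import Literature.InformationTheory.QuantumCodes.CSS
import HarnessLib

/-!
# MacKay–Mitchison–McFadden bicycle codes (Construction B): `H₀ = [C, Cᵀ]` is dual-containing — proved

Topic `Literature/InformationTheory/QuantumCodes`. Source followed: D. J. C. MacKay, G. Mitchison, P. L. McFadden,
*Sparse-graph codes for quantum error correction*, IEEE Trans. Inform. Theory 50 (2004) 2315–2330 =
arXiv:quant-ph/0304161 [MacKayMitchisonMcFadden2004] (held text `paper:arxiv-quant-ph_0304161`):

> §2.4.1 (chunk p0008 L1–7): «[the commutation condition] is satisfied if `A Aᵀ = 0`. This is equivalent to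
> `𝒞⊥(A) ⊂ 𝒞(A)`, where `𝒞(A)` is the code having `A` as its parity check matrix and `𝒞(A)⊥` is its dual code.
> We call such a code a 'dual-containing' code … (Dual-containing codes are also known as 'weakly self-dual
> codes'.)» §4.6 (chunk p0013 L87–107): «Construction B: 'B' is mnemonic for bicycle. To make a Bicycle code with
> row-weight `k`, blocklength `N`, and number of constraint nodes `M`, we take a random sparse `N/2 × N/2` cyclic
> matrix `C` with row-weight `k/2`, and define `H₀ = [C, Cᵀ]`. By construction, every pair that appears in `C`
> appears in `Cᵀ` also. Then we delete some rows from `H₀` to obtain a matrix `H` with `M` rows. … The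
> disadvantage of this construction is that the deleted rows are all low-weight codewords of weight `k`, which are
> unlikely to be in the dual.»

Formalisation (PROVED, no named facts): for any finite additive commutative group `G` as the cyclic index set
(`G = ℤ_{N/2}` in the paper; Mathlib's `Matrix.circulant`) and any commutative coefficient ring,
`bicycleMatrix c = [C | Cᵀ]` with `C = circulant c`; `bicycleMatrix_mul_transpose = 2 • (C Cᵀ)` (the two blocks
contribute `C Cᵀ + Cᵀ C` and circulants commute), hence `= 0` in characteristic two, and the same for every
row-deleted `H = H₀.submatrix f id`; `bicycleMatrix` is the abelian two-block pair `H_X = [A|B]`, `H_Z = [Bᵀ|Aᵀ]`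
of `AbelianTwoBlockCodes.lean` with `B = Aᵀ` (`b g = c (−g)`), where `H_X = H_Z`; the quantum code is the CSS code
`bicycleCode c f` with `H_X = H_Z = H` (the tree's `CSSCode`). The printed remark on deleted rows is the proved
`dX_bicycleCode_le`: a deleted row of `H₀` lies in `ker H`, so if it is not in the row space of `H` it is an
`X`-logical and `d_X ≤` its weight. Nothing probabilistic ("random sparse", "unlikely") is formalised.

`lean search` (2026-08-26): the two-block vocabulary `AbelianTwoBlock.HX/HZ`, `circulant_mul_comm`,
`transpose_circulant` exist; no bicycle / dual-containing `[C, Cᵀ]` declaration in Mathlib or the tree.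
-/

namespace Literature.InformationTheory.QuantumCodes

namespace Bicycle

open Matrix

variable {G : Type*} {R : Type*}

/-- MacKay's **bicycle matrix** `H₀ = [C, Cᵀ]`, `C = circulant c` a `G`-circulant (cyclic for `G = ℤ_{N/2}`).
[cite: MacKayMitchisonMcFadden2004, §4.6 Construction B (arXiv:quant-ph/0304161 chunk p0013 L87–93)] -/
def bicycleMatrix [Sub G] (c : G → R) : Matrix G (G ⊕ G) R :=
  fromCols (circulant c) (circulant c)ᵀ

/-- `H₀ = [C, Cᵀ]` unfolded. [cite: MacKayMitchisonMcFadden2004, §4.6 Construction B (arXiv:quant-ph/0304161 chunk p0013 L87–93)] -/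
theorem bicycleMatrix_def [Sub G] (c : G → R) : bicycleMatrix c = fromCols (circulant c) (circulant c)ᵀ := rfl

section TwoBlock

variable [AddCommGroup G]

/-- The bicycle matrix is the abelian two-block `H_X = [A | B]` with `B = Aᵀ = circulant (g ↦ c(−g))`.
[cite: MacKayMitchisonMcFadden2004, §4.6 Construction B (arXiv:quant-ph/0304161 chunk p0013 L87–93)] -/
theorem bicycleMatrix_eq_HX (c : G → R) : bicycleMatrix c = AbelianTwoBlock.HX c (fun g => c (-g)) := by
  rw [bicycleMatrix, AbelianTwoBlock.HX_def, transpose_circulant]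

/-- … and ALSO the two-block `H_Z = [Bᵀ | Aᵀ]` of the same pair: for bicycle codes `H_X = H_Z`.
[cite: MacKayMitchisonMcFadden2004, §4.6 Construction B (arXiv:quant-ph/0304161 chunk p0013 L87–93)] -/
theorem bicycleMatrix_eq_HZ (c : G → R) : bicycleMatrix c = AbelianTwoBlock.HZ c (fun g => c (-g)) := by
  rw [bicycleMatrix, AbelianTwoBlock.HZ_def, transpose_circulant, transpose_circulant]
  simp only [neg_neg]

variable [Fintype G] [CommRing R]

/-- **`H₀ H₀ᵀ = C Cᵀ + Cᵀ C = 2 • (C Cᵀ)`** (circulant matrices commute).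
[cite: MacKayMitchisonMcFadden2004, §4.6 Construction B (arXiv:quant-ph/0304161 chunk p0013 L93–94: "every pair that appears in C appears in Cᵀ also")] -/
theorem bicycleMatrix_mul_transpose (c : G → R) :
    bicycleMatrix c * (bicycleMatrix c)ᵀ = (2 : R) • (circulant c * (circulant c)ᵀ) := by
  rw [bicycleMatrix, transpose_fromCols, transpose_transpose, fromCols_mul_fromRows, transpose_circulant,
    circulant_mul_comm (fun i => c (-i)) c, two_smul]

/-- **Bicycle matrices are dual-containing in characteristic two**: `H₀ H₀ᵀ = 0` ("`A Aᵀ = 0` … we call such a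
code a 'dual-containing' code"). [cite: MacKayMitchisonMcFadden2004, §2.4.1 (arXiv:quant-ph/0304161 chunk p0008 L1–7) and §4.6 Construction B (chunk p0013 L87–94)] -/
theorem bicycleMatrix_mul_transpose_eq_zero (h2 : (2 : R) = 0) (c : G → R) :
    bicycleMatrix c * (bicycleMatrix c)ᵀ = 0 := by
  rw [bicycleMatrix_mul_transpose, h2, zero_smul]

/-- Row deletion preserves the dual-containing property: for `H = H₀` restricted to the kept rows `f : ρ → G`,
`H Hᵀ = 0`. [cite: MacKayMitchisonMcFadden2004, §4.6 Construction B (arXiv:quant-ph/0304161 chunk p0013 L96–99: "we delete some rows from H₀ to obtain a matrix H with M rows")] -/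
theorem submatrix_bicycleMatrix_mul_transpose_eq_zero (h2 : (2 : R) = 0) (c : G → R) {ρ : Type*} (f : ρ → G) :
    (bicycleMatrix c).submatrix f id * ((bicycleMatrix c).submatrix f id)ᵀ = 0 := by
  rw [transpose_submatrix, ← submatrix_mul _ _ f (id : G ⊕ G → G ⊕ G) f Function.bijective_id,
    bicycleMatrix_mul_transpose_eq_zero h2, submatrix_zero]
  rfl

end TwoBlock

/-! ### The bicycle CSS code `H_X = H_Z = H` over `𝔽₂` -/

section Code

variable [AddCommGroup G] [Fintype G]

/-- **MacKay's bicycle code** with kept rows `f : ρ → G`: the CSS code with `H_X = H_Z = H = [C, Cᵀ]` restricted to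
the rows `f` (a dual-containing classical code used for both kinds of checks).
[cite: MacKayMitchisonMcFadden2004, §2.4.1 and §4.6 Construction B (arXiv:quant-ph/0304161 chunks p0008 L1–7, p0013 L87–99)] -/
def bicycleCode (c : G → ZMod 2) {ρ : Type*} (f : ρ → G) : CSSCode ρ ρ (G ⊕ G) :=
  CSSCode.ofMatrices ((bicycleMatrix c).submatrix f id) ((bicycleMatrix c).submatrix f id)
    (submatrix_bicycleMatrix_mul_transpose_eq_zero rfl c f)

/-- `(bicycleCode c f).HX = H`. [cite: MacKayMitchisonMcFadden2004, §4.6 Construction B (arXiv:quant-ph/0304161 chunk p0013 L87–99)] -/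
@[simp] theorem bicycleCode_HX (c : G → ZMod 2) {ρ : Type*} (f : ρ → G) :
    (bicycleCode c f).HX = (bicycleMatrix c).submatrix f id := rfl

/-- `(bicycleCode c f).HZ = H` (the same matrix). [cite: MacKayMitchisonMcFadden2004, §4.6 Construction B (arXiv:quant-ph/0304161 chunk p0013 L87–99)] -/
@[simp] theorem bicycleCode_HZ (c : G → ZMod 2) {ρ : Type*} (f : ρ → G) :
    (bicycleCode c f).HZ = (bicycleMatrix c).submatrix f id := rfl

/-- Every row of the full `H₀` — in particular every DELETED row — is a codeword of `𝒞(H) = ker H` ("the deleted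
rows are all low-weight codewords of weight `k`"). [cite: MacKayMitchisonMcFadden2004, §4.6 Construction B (arXiv:quant-ph/0304161 chunk p0013 L107)] -/
theorem row_mem_ker (c : G → ZMod 2) {ρ : Type*} (f : ρ → G) (g : G) :
    (bicycleMatrix c).submatrix f id *ᵥ (bicycleMatrix c g) = 0 := by
  have h0 := bicycleMatrix_mul_transpose_eq_zero (R := ZMod 2) rfl c
  funext r
  have h := congr_fun (congr_fun h0 (f r)) g
  simp only [Matrix.mul_apply, Matrix.transpose_apply, Matrix.zero_apply] at h
  simpa [mulVec, dotProduct, submatrix_apply] using h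

/-- **The printed caveat, proved form**: if a deleted row `H₀_g` (weight `k`) is not in the row space of `H`, it
is a nontrivial `X`-logical, so `d_X ≤ wt(H₀_g)` ("the deleted rows are all low-weight codewords of weight `k`,
which are unlikely to be in the dual. Thus technically speaking we cannot make 'good' codes in this way").
[cite: MacKayMitchisonMcFadden2004, §4.6 Construction B (arXiv:quant-ph/0304161 chunk p0013 L107–110)] -/
theorem dX_bicycleCode_le (c : G → ZMod 2) {ρ : Type*} [Fintype ρ] (f : ρ → G) (g : G)
    (hg : bicycleMatrix c g ∉ (bicycleCode c f).rowSpX) :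
    (bicycleCode c f).dX ≤ hammingNorm (bicycleMatrix c g) :=
  (bicycleCode c f).dX_le_hammingNorm (row_mem_ker c f g) hg

end Code

end Bicycle

end Literature.InformationTheory.QuantumCodes
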